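import Literature.AlgebraicGeometry.Resolution.BaseTreeFinite
import Literature.AlgebraicGeometry.Resolution.QuadraticTransformsProofs
import HarnessLib

/-!
# Finiteness of the base tree over an ARBITRARY residue field (Zariski, via Abhyankar's union
# lemma and a König argument)

Topic: `Literature/AlgebraicGeometry/Resolution`. Zariski–Samuel II, Appendix 5: an ideal `J` of a
two-dimensional regular local ring `(R, 𝔪)` of the field `K = Frac R` becomes principal in all but
FINITELY many iterated quadratic transforms of `R` (the base points of `J`, infinitely near ones
included, are finitely many). `BaseTreeFinite.lean` proves this (`finite_idealBaseTree`,
`finite_baseTree`) under the hypothesis that the residue field of `R` is INFINITE (generic chart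
parameters for Huneke–Swanson's colength count, Lemma 14.3.4), and
`BaseTreeFiniteAnyResidueField.lean` removes the hypothesis for `𝔪`-primary `J` by Nagata's `R(X)`
transfer (`finite_setOf_subringDominates_not_isPrincipal`). This file gives a second, count-free proof
that needs neither the residue field nor finite colength (ANY ideal `J`), and records the vector form
`finite_baseTree'`:

* the tree of iterated quadratic transforms is finitely branching at bad points
  (`finite_setOf_isQuadraticTransform_not_isPrincipal`, no residue-field hypothesis), so an infinite
  base tree contains an infinite branch `R = R₀ → R₁ → R₂ → ⋯` of bad points (König);
* the union of such a branch is dominated by a valuation ring `W` (Chevalley), every step is then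
  the quadratic transform ALONG `W`, and by Abhyankar's union lemma (`AbhyankarQuadraticUnion_holds`,
  Abhyankar 1956, Lemma 12) `W = ⋃ Rᵢ`;
* `J W` is principal (a finitely generated ideal of a valuation ring), generated by an element
  `g₀ ∈ J` of least value; the finitely many quotients `g/g₀` of generators lie in `W`, hence in some
  `R_N` — so `J R_N = g₀ R_N` is principal, contradicting badness of `R_N`.

PROVED (no new definitions): `exists_valuationSubring_subringDominates_chain` (a chain of local subrings of `K`, each
dominating the previous one, is dominated by a valuation ring), `finite_idealBaseTree_of_isRegularLocalRing`
(any ideal, any residue field), `finite_baseTree'` (vectors, any residue field).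

## References

* O. Zariski, P. Samuel, *Commutative Algebra* II (1960), Appendix 5. [ZariskiSamuel1960]
* S. S. Abhyankar, *On the valuations centered in a local domain*, Amer. J. Math. 78 (1956),
  Lemma 12, Thm. 3. [Abhyankar1956Valuations]
* S. D. Cutkosky, Math. Ann. 362 (2015) (arXiv:1404.7459), Lemma 2.2. [Cutkosky2014]
-/

noncomputable section

open IsLocalRing

namespace Literature.AlgebraicGeometry.Resolution

universe u

variable {K : Type u} [Field K]

/-! ## A chain of dominating local subrings is dominated by a valuation ring -/

/-- **Chevalley for a chain**: if `R₀ ≤ R₁ ≤ ⋯` are local subrings of `K`, each dominating the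
previous one, some valuation ring `W` of `K` dominates every `Rᵢ` (the union is a local subring;
apply Chevalley's extension theorem, Mathlib's `LocalSubring.exists_le_valuationSubring`).
[cite: ZariskiSamuel1960, Ch. VI §4, Thm. 5] -/
theorem exists_valuationSubring_subringDominates_chain (R : ℕ → Subring K)
    (hloc : ∀ i, IsLocalRing (R i)) (hdom : ∀ i, SubringDominates (R i) (R (i + 1))) :
    ∃ W : ValuationSubring K, ∀ i, SubringDominates (R i) W.toSubring := by
  classical
  have hmono : Monotone R := monotone_nat_of_le_succ fun i => (hdom i).1
  have hdom' : ∀ i j, i ≤ j → SubringDominates (R i) (R j) := by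
    intro i j hij
    induction hij with
    | refl => exact SubringDominates.refl _
    | step _ ih => exact ih.trans (hdom _)
  -- adapted from `exists_valuationSubring_dominates_of_chain'` (`DominatedUnions.lean`)
  set U : Subring K := ⨆ i, R i with hU
  have hdir : Directed (· ≤ ·) R := hmono.directed_le
  have hmemU : ∀ x, x ∈ U ↔ ∃ i, x ∈ R i := fun x => Subring.mem_iSup_of_directed hdir
  have hRU : ∀ i, R i ≤ U := fun i => le_iSup R i
  have hinvU : ∀ i x, x ∈ R i → x⁻¹ ∈ U → x⁻¹ ∈ R i := by
    intro i x hx hxU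
    obtain ⟨j, hj⟩ := (hmemU _).mp hxU
    exact (hdom' i (max i j) (le_max_left i j)).2 x hx (hmono (le_max_right i j) hj)
  haveI hUloc : IsLocalRing U := by
    refine IsLocalRing.of_nonunits_add ?_
    intro a b ha hb
    rw [mem_nonunits_iff] at ha hb ⊢
    intro hab
    obtain ⟨hab0, habinv⟩ := (isUnit_subring_iff_inv_mem _).mp hab
    obtain ⟨i, hi⟩ := (hmemU _).mp a.2
    obtain ⟨j, hj⟩ := (hmemU _).mp b.2
    set k := max i j
    have hak : (a : K) ∈ R k := hmono (le_max_left i j) hi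
    have hbk : (b : K) ∈ R k := hmono (le_max_right i j) hj
    haveI := hloc k
    have habk : IsUnit (⟨(a : K) + b, (R k).add_mem hak hbk⟩ : R k) := by
      rw [isUnit_subring_iff_inv_mem]
      exact ⟨hab0, hinvU k _ ((R k).add_mem hak hbk) habinv⟩
    have habk' : (⟨(a : K) + b, (R k).add_mem hak hbk⟩ : R k) = ⟨a, hak⟩ + ⟨b, hbk⟩ := rfl
    rw [habk'] at habk
    rcases IsLocalRing.isUnit_or_isUnit_of_isUnit_add habk with hu | hu
    · obtain ⟨h0, hinv⟩ := (isUnit_subring_iff_inv_mem _).mp hu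
      exact ha ((isUnit_subring_iff_inv_mem _).mpr ⟨h0, hRU k hinv⟩)
    · obtain ⟨h0, hinv⟩ := (isUnit_subring_iff_inv_mem _).mp hu
      exact hb ((isUnit_subring_iff_inv_mem _).mpr ⟨h0, hRU k hinv⟩)
  -- Chevalley: a valuation ring dominating `U`
  obtain ⟨W, hW⟩ := (LocalSubring.mk U).exists_le_valuationSubring
  haveI : IsLocalRing W.toSubring := W.toLocalSubring.isLocalRing
  have hUW : SubringDominates U W.toSubring := (subringDominates_iff U W.toSubring).mpr hW
  exact ⟨W, fun i => ⟨(hRU i).trans hUW.1,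
    fun x hx hxW => hinvU i x hx (hUW.2 x (hRU i hx) hxW)⟩⟩

/-! ## Extensions of ideals along the tree -/

section Ext

variable {R : Subring K}

/-- The extension of a span is the span of the same elements. [folklore] -/
private theorem extIdeal_span_image (s : Set R) {S : Subring K} (h : R ≤ S) :
    extIdeal (Ideal.span s) S = Ideal.span (Subring.inclusion h '' s) := by
  rw [extIdeal_eq_map _ h, Ideal.map_span]

/-- If every generator of `J` is a multiple IN `S` of one fixed non-zero `g₀ ∈ J` — i.e. all the
quotients `g / g₀` lie in `S ⊇ R` — then `J S = g₀ S` is principal. [folklore] -/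
private theorem isPrincipal_extIdeal_of_forall_div_mem {S : Subring K} (h : R ≤ S) (s : Finset R)
    {J : Ideal R} (hJ : J = Ideal.span (s : Set R)) {g₀ : R} (hg₀J : g₀ ∈ J)
    (hg₀ : (g₀ : K) ≠ 0) (hdiv : ∀ g ∈ s, (g : K) / (g₀ : K) ∈ S) :
    (extIdeal J S).IsPrincipal := by
  refine ⟨⟨Subring.inclusion h g₀, le_antisymm ?_ ?_⟩⟩
  · rw [hJ, extIdeal_span_image _ h, Ideal.submodule_span_eq, Ideal.span_le]
    rintro _ ⟨g, hg, rfl⟩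
    rw [SetLike.mem_coe, Ideal.mem_span_singleton']
    refine ⟨⟨(g : K) / (g₀ : K), hdiv g hg⟩, Subtype.ext ?_⟩
    change (g : K) / (g₀ : K) * (g₀ : K) = (g : K)
    rw [div_mul_cancel₀ _ hg₀]
  · rw [Ideal.submodule_span_eq, Ideal.span_le, Set.singleton_subset_iff, SetLike.mem_coe,
      extIdeal_eq_map _ h]
    exact Ideal.mem_map_of_mem _ hg₀J

end Ext

/-! ## Finite branching: the bad first quadratic transforms of a node -/

section Branch

variable {R : Subring K}

/-- **Finitely many first quadratic transforms of a two-dimensional regular local ring `S` fail to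
principalize a given ideal `I` of `S`** — `finite_setOf_isQuadraticTransform_not_isPrincipal` with
the bookkeeping (order of `I`, a regular system of parameters) discharged; no hypothesis on the
residue field. [cite: ZariskiSamuel1960, Appendix 5] -/
theorem finite_setOf_isQuadraticTransform_not_isPrincipal' (S : Subring K) [IsRegularLocalRing S]
    (hdim : ringKrullDim S = 2) (I : Ideal S) :
    {S₁ : Subring K | IsQuadraticTransform S S₁ ∧ ¬ (extIdeal I S₁).IsPrincipal}.Finite := by
  classical
  haveI := isDomain_of_isRegularLocalRing S
  -- `I = ⊥` or `I = ⊤`: no bad transform at all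
  by_cases hI0 : I = ⊥
  · subst hI0
    refine Set.finite_empty.subset ?_
    rintro S₁ ⟨h₁, hbad⟩
    exact hbad (by rw [extIdeal_eq_map _ h₁.dominates.1, Ideal.map_bot]; exact ⟨⟨0, by simp⟩⟩)
  by_cases hItop : I = ⊤
  · subst hItop
    refine Set.finite_empty.subset ?_
    rintro S₁ ⟨h₁, hbad⟩
    exact hbad (by rw [extIdeal_eq_map _ h₁.dominates.1, Ideal.map_top]; exact ⟨⟨1, by simp⟩⟩)
  have hIm : I ≤ maximalIdeal S := le_maximalIdeal hItop
  -- the order `r` of `I` (adapted from `finite_idealBaseTree`)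
  have hex : ∃ k, ¬ I ≤ maximalIdeal S ^ (k + 1) := by
    by_contra hall
    push Not at hall
    apply hI0
    rw [← le_bot_iff, ← Ideal.iInf_pow_eq_bot_of_isLocalRing (maximalIdeal S)
      (maximalIdeal.isMaximal S).ne_top]
    refine le_iInf fun k => ?_
    cases k with
    | zero => simp
    | succ k => exact hall k
  set r := Nat.find hex with hrdef
  have hIr : ¬ I ≤ maximalIdeal S ^ (r + 1) := Nat.find_spec hex
  have hI : I ≤ maximalIdeal S ^ r := by
    rcases Nat.eq_zero_or_pos r with h0 | hpos
    · rw [h0, pow_zero, Ideal.one_eq_top]; exact le_top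
    · have := Nat.find_min hex (show r - 1 < r by omega)
      push Not at this
      rwa [show r - 1 + 1 = r by omega] at this
  -- a regular system of parameters
  obtain ⟨u, v, huv, hup, hvp, huv', hvu'⟩ := exists_maximalIdeal_eq_span_pair hdim
  have hu0 : u ≠ 0 := hup.ne_zero
  have hv0 : v ≠ 0 := hvp.ne_zero
  have hpq : ∀ t, u ∣ v * t → u ∣ t := fun t ht => (hup.dvd_or_dvd ht).resolve_left huv'
  have hqp : ∀ t, v ∣ u * t → v ∣ t := fun t ht => (hvp.dvd_or_dvd ht).resolve_left hvu'
  exact finite_setOf_isQuadraticTransform_not_isPrincipal hdim huv hu0 hv0 hpq hqp hI hIr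

/-- Transitivity of extension in the form used along the tree: for `R ≤ S ≤ S₁`,
`(J S) S₁` is principal iff `J S₁` is. [folklore] -/
private theorem isPrincipal_extIdeal_extIdeal_iff {J : Ideal R} {S S₁ : Subring K} (h : R ≤ S)
    (h₁ : S ≤ S₁) : (extIdeal (extIdeal J S) S₁).IsPrincipal ↔ (extIdeal J S₁).IsPrincipal := by
  rw [extIdeal_eq_map (extIdeal J S) h₁, map_extIdeal J h h₁]

end Branch

/-! ## The König step and the branch -/

section Konig

variable {R : Subring K}

/-- The bad transforms above `S` decompose through the bad FIRST transforms of `S`. [folklore] -/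
private theorem badAbove_subset (J : Ideal R) {S : Subring K} (hRS : R ≤ S) :
    {S' : Subring K | Relation.ReflTransGen IsQuadraticTransform S S' ∧ ¬ (extIdeal J S').IsPrincipal} ⊆ {S} ∪ ⋃ S₁ ∈ {S₁ : Subring K | IsQuadraticTransform S S₁ ∧
      ¬ (extIdeal J S₁).IsPrincipal}, {S' : Subring K | Relation.ReflTransGen IsQuadraticTransform S₁ S' ∧ ¬ (extIdeal J S').IsPrincipal} := by
  rintro S' ⟨hS', hbad'⟩
  rcases reflTransGen_iff_eq_or_exists_head.mp hS' with rfl | ⟨S₁, h₁, h₂⟩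
  · exact Or.inl rfl
  · right
    haveI := h₁.isLocalRing
    have hS₁bad : ¬ (extIdeal J S₁).IsPrincipal := fun hp =>
      hbad' (isPrincipal_extIdeal_of_le (hRS.trans h₁.dominates.1)
        (subringDominates_of_reflTransGen h₂).1 hp)
    exact Set.mem_iUnion₂.mpr ⟨S₁, ⟨h₁, hS₁bad⟩, h₂, hbad'⟩

/-- **König step.** Above a two-dimensional regular local ring `S` of `K` reached from `R` by
quadratic transforms, if infinitely many iterated transforms are bad for `J`, then so is the case
above one of the finitely many bad FIRST transforms `S₁` of `S`, which is again a two-dimensional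
regular local ring of `K`. [cite: ZariskiSamuel1960, Appendix 5] -/
theorem exists_child_infinite (J : Ideal R) {S : Subring K} [IsRegularLocalRing S]
    (hS2 : ringKrullDim S = 2) (hSK : IsLocalRingOf S)
    (hRS : Relation.ReflTransGen IsQuadraticTransform R S) (hinf : ({S' : Subring K | Relation.ReflTransGen IsQuadraticTransform S S' ∧ ¬ (extIdeal J S').IsPrincipal}).Infinite) :
    ∃ S₁ : Subring K, IsQuadraticTransform S S₁ ∧ ¬ (extIdeal J S₁).IsPrincipal ∧
      IsRegularLocalRing S₁ ∧ ringKrullDim S₁ = 2 ∧ IsLocalRingOf S₁ ∧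
      ({S' : Subring K | Relation.ReflTransGen IsQuadraticTransform S₁ S' ∧ ¬ (extIdeal J S').IsPrincipal}).Infinite := by
  classical
  have hRS' : R ≤ S := (subringDominates_of_reflTransGen hRS).1
  set BAD₁ : Set (Subring K) :=
    {S₁ : Subring K | IsQuadraticTransform S S₁ ∧ ¬ (extIdeal J S₁).IsPrincipal} with hBAD₁
  -- `BAD₁` = bad first transforms for the ideal `J S` of `S`: finite
  have hfin : BAD₁.Finite := by
    refine (finite_setOf_isQuadraticTransform_not_isPrincipal' S hS2 (extIdeal J S)).subset ?_
    rintro S₁ ⟨h₁, hbad⟩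
    exact ⟨h₁, fun hp => hbad ((isPrincipal_extIdeal_extIdeal_iff hRS' h₁.dominates.1).mp hp)⟩
  -- some bad child has infinitely many bad transforms above it
  have hex : ∃ S₁ ∈ BAD₁, ({S' : Subring K | Relation.ReflTransGen IsQuadraticTransform S₁ S' ∧ ¬ (extIdeal J S').IsPrincipal}).Infinite := by
    by_contra hall
    push Not at hall
    apply hinf
    refine ((Set.finite_singleton S).union (hfin.biUnion' fun S₁ hS₁ => ?_)).subset
      (badAbove_subset J hRS')
    exact hall S₁ hS₁
  obtain ⟨S₁, ⟨h₁, hbad⟩, hinf₁⟩ := hex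
  haveI := h₁.isLocalRing
  -- a bad child is not a valuation ring, hence regular of dimension two
  have hreg : IsRegularLocalRing S₁ ∧ ringKrullDim S₁ = 2 := by
    rcases h₁.mem_or_inv_mem_or_isRegularLocalRing hS2 hSK with hval | hreg
    · exfalso
      haveI : IsNoetherianRing S₁ := by
        obtain ⟨_, x, hxm, hx0, _, hT, hfrac, hdom⟩ := id h₁
        haveI : IsNoetherianRing (blowupRing S (x : K)) := by
          have hx2 : x ∉ maximalIdeal S ^ 2 := IsQuadraticTransform.chart_not_mem_sq hT hdom hx0
          obtain ⟨y, hm, -, -⟩ := exists_maximalIdeal_eq_span_pair_of_not_mem_sq hS2 hxm hx2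
          rw [blowupRing_eq_adjoin hm]
          exact isNoetherianRing_adjoin_toSubring S _
        set Q : Ideal (blowupRing S (x : K)) :=
          (maximalIdeal S₁).comap (Subring.inclusion hT) with hQ
        rw [h₁.eq_ofPrime_of_le hxm hx0 le_rfl hT]
        exact isNoetherianRing_ofPrime (A := blowupRing S (x : K)) (P := Q)
      exact hbad (isPrincipal_of_forall_mem_or_inv_mem hval _)
    · exact hreg
  exact ⟨S₁, h₁, hbad, hreg.1, hreg.2, h₁.isLocalRingOf hSK, hinf₁⟩

end Konig

/-! ## The finiteness theorem -/

/-- **Finiteness of the base tree of an ideal — any residue field** (Zariski–Samuel II, App. 5): for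
a two-dimensional regular local ring `R` of `K = Frac R` and any ideal `J` of `R`, only finitely many
iterated quadratic transforms of `R` fail to principalize `J`. Proof by König's argument, Chevalley
and Abhyankar's union lemma, as in the file header. [cite: ZariskiSamuel1960, Appendix 5] -/
theorem finite_idealBaseTree_of_isRegularLocalRing (R : Subring K) [IsRegularLocalRing R]
    (hdim : ringKrullDim R = 2) (hRK : IsLocalRingOf R) (J : Ideal R) :
    (idealBaseTree R J).Finite := by
  classical
  by_contra hinf
  rw [Set.not_finite] at hinf
  haveI := isDomain_of_isRegularLocalRing R
  -- nodes: two-dimensional regular local rings of `K` above `R` with infinitely many bad transforms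
  let P : Subring K → Prop := fun S => ∃ (_ : IsRegularLocalRing S), ringKrullDim S = 2 ∧
    IsLocalRingOf S ∧ Relation.ReflTransGen IsQuadraticTransform R S ∧ ({S' : Subring K | Relation.ReflTransGen IsQuadraticTransform S S' ∧ ¬ (extIdeal J S').IsPrincipal}).Infinite
  have hP0 : P R := ⟨‹_›, hdim, hRK, Relation.ReflTransGen.refl, hinf⟩
  have step : ∀ S, P S → ∃ S₁, P S₁ ∧ IsQuadraticTransform S S₁ ∧
      ¬ (extIdeal J S₁).IsPrincipal := by
    rintro S ⟨hreg, hS2, hSK, hRS, hinfS⟩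
    haveI := hreg
    obtain ⟨S₁, h₁, hbad, hreg₁, hS₁2, hS₁K, hinf₁⟩ :=
      exists_child_infinite J hS2 hSK hRS hinfS
    exact ⟨S₁, ⟨hreg₁, hS₁2, hS₁K, hRS.tail h₁, hinf₁⟩, h₁, hbad⟩
  choose next hnextP hnextQT hnextbad using step
  -- the infinite branch
  let seq : ℕ → {S : Subring K // P S} :=
    fun n => Nat.rec ⟨R, hP0⟩ (fun _ S => ⟨next S.1 S.2, hnextP S.1 S.2⟩) n
  let Rs : ℕ → Subring K := fun n => (seq n).1
  have hRs0 : Rs 0 = R := rfl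
  have hRsP : ∀ n, P (Rs n) := fun n => (seq n).2
  have hRsQT : ∀ n, IsQuadraticTransform (Rs n) (Rs (n + 1)) := fun n =>
    hnextQT (seq n).1 (seq n).2
  have hRsbad : ∀ n, ¬ (extIdeal J (Rs (n + 1))).IsPrincipal := fun n =>
    hnextbad (seq n).1 (seq n).2
  have hloc : ∀ n, IsLocalRing (Rs n) := fun n => (hRsP n).1.toIsLocalRing
  have hdomRs : ∀ n, SubringDominates (Rs n) (Rs (n + 1)) := fun n => (hRsQT n).dominates
  -- a valuation ring dominating the branch; the branch is the quadratic sequence along it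
  obtain ⟨W, hW⟩ := exists_valuationSubring_subringDominates_chain Rs hloc hdomRs
  have halong : ∀ i, IsQuadraticTransformAlong W (Rs i) (Rs (i + 1)) := by
    intro i
    haveI := (hRsP i).1
    exact (hRsQT i).along ⟨inferInstance, IsNoetherian.noetherian _⟩ (hW (i + 1))
  have hunion := AbhyankarQuadraticUnion_holds K W Rs (by rw [hRs0]; infer_instance)
    (by rw [hRs0]; exact hdim) (by rw [hRs0]; exact hRK) (hW 0) halong
  -- `J W` is principal: a generator of least value among finitely many generators of `J`
  by_cases hJ0 : J = ⊥
  · apply hRsbad 0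
    rw [hJ0, extIdeal_eq_map _ (hdomRs 0).1, Ideal.map_bot]
    exact ⟨⟨0, by simp⟩⟩
  obtain ⟨s, hs⟩ := (IsNoetherian.noetherian J : J.FG)
  have hsne : (s.filter fun g : R => (g : K) ≠ 0).Nonempty := by
    by_contra hempty
    rw [Finset.not_nonempty_iff_eq_empty, Finset.filter_eq_empty_iff] at hempty
    apply hJ0
    rw [← hs, Ideal.span_eq_bot]
    intro g hg
    have := hempty hg
    push Not at this
    exact Subtype.ext this
  obtain ⟨g₀, hg₀s, hmax⟩ := Finset.exists_max_image (s.filter fun g : R => (g : K) ≠ 0)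
    (fun g => W.valuation (g : K)) hsne
  obtain ⟨hg₀s', hg₀0⟩ := Finset.mem_filter.mp hg₀s
  have hg₀J : g₀ ∈ J := hs ▸ Ideal.subset_span hg₀s'
  -- every `g / g₀` lies in `W`, hence in some member of the branch
  have hdivW : ∀ g ∈ s, (g : K) / (g₀ : K) ∈ W := by
    intro g hg
    by_cases hg0 : (g : K) = 0
    · rw [hg0, zero_div]; exact W.zero_mem
    · rw [← W.valuation_le_one_iff, map_div₀, div_le_one₀
        (pos_iff_ne_zero.mpr ((map_ne_zero _).mpr hg₀0))]
      exact hmax g (Finset.mem_filter.mpr ⟨hg, hg0⟩)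
  have hdivRs : ∀ g ∈ s, ∃ i, (g : K) / (g₀ : K) ∈ Rs i := fun g hg =>
    (hunion _).mp (hdivW g hg)
  choose! ι hι using hdivRs
  have hmono : Monotone Rs := monotone_nat_of_le_succ fun i => (hdomRs i).1
  have hall : ∀ g ∈ s, (g : K) / (g₀ : K) ∈ Rs (s.sup ι + 1) := fun g hg =>
    hmono ((Finset.le_sup hg).trans (Nat.le_succ _)) (hι g hg)
  -- so `J R_N` is principal, `N = s.sup ι + 1`: contradiction
  have hRle : R ≤ Rs (s.sup ι + 1) := by
    have h := hmono (Nat.zero_le (s.sup ι + 1))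
    rwa [hRs0] at h
  exact hRsbad (s.sup ι) (isPrincipal_extIdeal_of_forall_div_mem hRle s hs.symm hg₀J hg₀0 hall)

/-- **Finiteness of the base tree of a vector — any residue field** (`finite_baseTree` without
`Infinite (ResidueField R)`): for a two-dimensional regular local ring `R` of `K = Frac R` and a
non-zero `w ∈ Kⁿ⁺¹`, only finitely many iterated quadratic transforms of `R` are base points of
`(w₀ : … : wₙ)`. [cite: ZariskiSamuel1960, Appendix 5] -/
theorem finite_baseTree' {R : Subring K} [IsRegularLocalRing R] (hdim : ringKrullDim R = 2)
    (hRK : IsLocalRingOf R) {n : ℕ} (w : Fin (n + 1) → K) (hw : ∃ i, w i ≠ 0) :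
    (baseTree R w).Finite := by
  haveI := isDomain_of_isRegularLocalRing R
  obtain ⟨c, hc0, hc⟩ := exists_forall_mul_mem hRK w
  refine (finite_idealBaseTree_of_isRegularLocalRing R hdim hRK (coordIdeal w c hc)).subset ?_
  rintro R' ⟨hR', hdef⟩
  haveI : IsLocalRing R' := isLocalRing_of_reflTransGen hR'
  have hRR' : R ≤ R' := (subringDominates_of_reflTransGen hR').1
  exact ⟨hR', fun hp => hdef ((definedOn_iff_isPrincipal_extIdeal w hw c hc0 hc hRR').mpr hp)⟩

end Literature.AlgebraicGeometry.Resolution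

end
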